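import Mathlib
import Summits.ValiantsHypothesis.ValiantsHypothesis.Theorems.NewtonUnitEquationsDissociatedUniformTotalsLawTripleExchange
import HarnessLib

/-!
# Crux `NewtonUnitEquations.DissociatedUniform` (stmt-ValiantsHypothesis-5905): TRIPLE CHAIN LOCALISATION of class tops
# (the `n = 3` form of the chain lemma of `…TotalsLawChains`)

On the cyclically-unimodal stratum (at a weight `w` for which the three label sequences `α = ⟨w, a·⟩`, `β = ⟨w, b·⟩`,
`γ = ⟨w, c·⟩` are cyclically unimodal, modes `m_α = n_α + d_α`, `m_β`, `m_γ`, `m = m_α + m_β + m_γ`; this contains the whole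
hodograph-convex = SMOOTH stratum of `…TotalsLawHodograph*`, where every weight qualifies), a strict `w`-top `p` of the
class `s` (a hull vertex exposed by `w`) is

* a FORWARD SIMPLEX point: `p = a(m_α + i) + b(m_β + j) + c(m_γ + k)` with all three letters on the DESCENDING arcs after their
  modes and `i + j + k = ŝ < q`, where `m + ŝ = s` (so `ŝ` is the forward distance from the mode class `m` to `s`), or
* a BACKWARD SIMPLEX point: `p = a(m_α − i) + b(m_β − j) + c(m_γ − k)` on the ascending arcs with `i + j + k < q`, `m − (i+j+k) = s`
  (so `i + j + k = q − ŝ` unless `s = m`):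

`exists_triple_chain_of_isStrictTop`.  In particular the mode class `s = m` has the mode triple as its only possible strict top
(`eq_modes_of_isStrictTop`).  The proof is a two-letter EXCHANGE (`exchange_fwd_bwd` of the companion `…TotalsLawTripleExchange`: a strictly-forward letter and a
strictly-backward letter of a strict top can be moved one step towards their modes without leaving the class or losing height,
so by strictness the moved triple represents the same point) followed by a same-side REDUCTION (`chain_of_forward` /
`chain_of_backward`: offsets of one sign summing to `≥ q` are dominated by componentwise smaller offsets of the same residue).
No injectivity and no general position are assumed (the conclusion is about SOME representing triple of the point `p`).

Why this is the right first brick for the sharp law on the smooth stratum (memo `Cruxes/DissociatedUniform/NOTES-t1g8.md`):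
it is the `n = 3` analogue of the pair localisation behind the kinetic census of NOTES-t1g6 §3, it exhibits the one-winner
structure of a class as a MIN-PLUS / resource-allocation problem over the simplex `{i + j + k = ŝ}` (top = `argmax F(i)+G(j)+H(k)`
with `F, G, H` the descents from the modes), and the census of this generation shows that the forward simplex CAN be swept by a
single class (a smooth configuration with one class of `≈ q²/2` hull vertices), so that — unlike for pairs (`…TotalsLawLeftTurning`:
`≤ 12q` per union, uniformly) — no POINTWISE `O(q)` bound holds for triples on the smooth stratum and the law `T ≤ 2q² + O(q)` there
is a genuinely amortised statement.
Honest label: structural lemma; `SmoothSharpTotalsLaw`, `HexTopBound`, `TotalsLawThree` remain OPEN; nothing here bears on VP ≠ VNP.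
[folklore: exchange / domination arguments for separable objectives with unimodal summands]
-/

set_option linter.dupNamespace false -- `ValiantsHypothesis.ValiantsHypothesis` (summit = problem) in every name

open scoped BigOperators Pointwise

namespace Summit.ValiantsHypothesis.ValiantsHypothesis.Theorems.NewtonUnitEquationsDissociatedUniform

namespace TotalsLaw

open Literature.Computability.AlgebraicComplexity.KPTT.PlanarMinkowski

section TripleChains

variable {q : ℕ} [NeZero q]

variable {a b c : ZMod q → (Fin 2 → ℝ)}

/-- **TRIPLE CHAIN LOCALISATION.**  On the cyclically-unimodal stratum at the weight `w` (modes `m_α = n_α + d_α`, `m_β`, `m_γ`),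
every strict `w`-top `p` of the class `s` is a forward simplex point `a(m_α + i) + b(m_β + j) + c(m_γ + k)` (letters on the
descending arcs, `i + j + k < q`, `m + (i + j + k) = s`) or a backward simplex point `a(m_α − i) + b(m_β − j) + c(m_γ − k)` (letters
on the ascending arcs, `i + j + k < q`, `m − (i + j + k) = s`). [folklore] -/
theorem exists_triple_chain_of_isStrictTop {w : Fin 2 → ℝ} {nα nβ nγ : ZMod q} {dα dβ dγ : ℕ}
    (hα : CycUnimodalAt (fun x => w ⬝ᵥ a x) nα dα) (hβ : CycUnimodalAt (fun y => w ⬝ᵥ b y) nβ dβ)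
    (hγ : CycUnimodalAt (fun z => w ⬝ᵥ c z) nγ dγ) {s : ZMod q} {p : Fin 2 → ℝ}
    (htop : IsStrictTop w (classFin a b c s) p) :
    (∃ i j k : ℕ, dα + i < q ∧ dβ + j < q ∧ dγ + k < q ∧ i + j + k < q ∧
        nα + (dα : ZMod q) + (nβ + (dβ : ZMod q)) + (nγ + (dγ : ZMod q)) + ((i + j + k : ℕ) : ZMod q) = s ∧
        p = a (nα + (dα : ZMod q) + (i : ZMod q)) + b (nβ + (dβ : ZMod q) + (j : ZMod q)) +
          c (nγ + (dγ : ZMod q) + (k : ZMod q))) ∨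
      (∃ i j k : ℕ, i ≤ dα ∧ j ≤ dβ ∧ k ≤ dγ ∧ i + j + k < q ∧
        nα + (dα : ZMod q) + (nβ + (dβ : ZMod q)) + (nγ + (dγ : ZMod q)) - ((i + j + k : ℕ) : ZMod q) = s ∧
        p = a (nα + (dα : ZMod q) - (i : ZMod q)) + b (nβ + (dβ : ZMod q) - (j : ZMod q)) +
          c (nγ + (dγ : ZMod q) - (k : ZMod q))) := by
  classical
  have hdα : dα < q := hα.1
  have hdβ : dβ < q := hβ.1
  have hdγ : dγ < q := hγ.1
  -- a representing triple
  obtain ⟨⟨x, y⟩, -, hpxy⟩ := Finset.mem_image.1 htop.mem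
  set z : ZMod q := s - x - y with hz
  have hp : p = a x + b y + c z := hpxy.symm
  have hxyz : x + y + z = s := by rw [hz]; ring
  -- symmetric copies of the class
  have hF12 : classFin b a c s = classFin a b c s := (classFin_swap12 a b c s).symm
  have hF23 : classFin a c b s = classFin a b c s := (classFin_swap23 a b c s).symm
  have hF13 : classFin c b a s = classFin a b c s := (classFin_swap13 a b c s).symm
  have hFr : classFin b c a s = classFin a b c s := (classFin_rotate a b c s).symm
  have hFrr : classFin c a b s = classFin a b c s := by rw [← classFin_rotate b c a, ← classFin_rotate a b c]
  -- offsets of the three letters (descending arc after / ascending arc before the mode), eight side patterns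
  rcases exists_offset nα dα x with ⟨i, hi, hx⟩ | ⟨i, hi, hx⟩ <;>
    rcases exists_offset nβ dβ y with ⟨j, hj, hy⟩ | ⟨j, hj, hy⟩ <;>
    rcases exists_offset nγ dγ z with ⟨k, hk, hzo⟩ | ⟨k, hk, hzo⟩ <;>
    rw [hx, hy, hzo] at hxyz hp
  · -- F F F
    exact Or.inl (chain_of_forward hα hβ hγ htop hi hj hk hxyz hp)
  · -- F F B
    have hs0 : nα + (dα : ZMod q) + (i : ZMod q) + (nβ + (dβ : ZMod q) + (j : ZMod q)) + (nγ + (dγ : ZMod q) - (k : ZMod q)) = s := by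
      linear_combination hxyz
    have hp0 : p = a (nα + (dα : ZMod q) + (i : ZMod q)) + b (nβ + (dβ : ZMod q) + (j : ZMod q)) + c (nγ + (dγ : ZMod q) - (k : ZMod q)) :=
      hp
    have E0 := exchange_fwd_bwd a b c hα hγ htop hi hk hs0 hp0
    rcases le_total (k) (i) with h0a | h0b
    · have hrep0a := E0 (k) h0a le_rfl
      rw [Nat.sub_self] at hrep0a
      refine Or.inl (chain_of_forward hα hβ hγ htop (i := i - k) (j := j) (k := 0)
        (by omega) hj (by omega) ?_ ?_)
      · rw [Nat.cast_sub h0a, Nat.cast_zero]; linear_combination hxyz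
      · simpa using hrep0a
    · have hrep0b := E0 (i) le_rfl h0b
      rw [Nat.sub_self] at hrep0b
      have hs1 : nβ + (dβ : ZMod q) + (j : ZMod q) + (nα + (dα : ZMod q) + ((0 : ℕ) : ZMod q)) + (nγ + (dγ : ZMod q) - ((k - i : ℕ) : ZMod q)) = s := by
        rw [Nat.cast_sub h0b, Nat.cast_zero]; linear_combination hxyz
      have hp1 : p = b (nβ + (dβ : ZMod q) + (j : ZMod q)) + a (nα + (dα : ZMod q) + ((0 : ℕ) : ZMod q)) + c (nγ + (dγ : ZMod q) - ((k - i : ℕ) : ZMod q)) := by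
        rw [hrep0b]; abel
      have htop1 : IsStrictTop w (classFin b a c s) p := by rw [hF12]; exact htop
      have E1 := exchange_fwd_bwd b a c hβ hγ htop1 hj (by omega : k - i ≤ dγ) hs1 hp1
      rcases le_total (k - i) (j) with h1a | h1b
      · have hrep1a := E1 (k - i) h1a le_rfl
        rw [Nat.sub_self] at hrep1a
        refine Or.inl (chain_of_forward hα hβ hγ htop (i := 0) (j := j - (k - i)) (k := 0)
          (by omega) (by omega) (by omega) ?_ ?_)
        · rw [Nat.cast_sub h1a, Nat.cast_sub h0b, Nat.cast_zero]; linear_combination hxyz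
        · rw [hrep1a]; simp only [Nat.cast_zero, add_zero, sub_zero]; abel
      · have hrep1b := E1 (j) le_rfl h1b
        rw [Nat.sub_self] at hrep1b
        refine Or.inr (chain_of_backward hα hβ hγ htop (i := 0) (j := 0) (k := k - i - j)
          (by omega) (by omega) (by omega) ?_ ?_)
        · rw [Nat.cast_sub h1b, Nat.cast_sub h0b, Nat.cast_zero]; linear_combination hxyz
        · rw [hrep1b]; simp only [Nat.cast_zero, add_zero, sub_zero]; abel
  · -- F B F
    have hs0 : nα + (dα : ZMod q) + (i : ZMod q) + (nγ + (dγ : ZMod q) + (k : ZMod q)) + (nβ + (dβ : ZMod q) - (j : ZMod q)) = s := by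
      linear_combination hxyz
    have hp0 : p = a (nα + (dα : ZMod q) + (i : ZMod q)) + c (nγ + (dγ : ZMod q) + (k : ZMod q)) + b (nβ + (dβ : ZMod q) - (j : ZMod q)) := by
      rw [hp]; abel
    have htop0 : IsStrictTop w (classFin a c b s) p := by rw [hF23]; exact htop
    have E0 := exchange_fwd_bwd a c b hα hβ htop0 hi hj hs0 hp0
    rcases le_total (j) (i) with h0a | h0b
    · have hrep0a := E0 (j) h0a le_rfl
      rw [Nat.sub_self] at hrep0a
      refine Or.inl (chain_of_forward hα hβ hγ htop (i := i - j) (j := 0) (k := k)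
        (by omega) (by omega) hk ?_ ?_)
      · rw [Nat.cast_sub h0a, Nat.cast_zero]; linear_combination hxyz
      · rw [hrep0a]; simp only [Nat.cast_zero, add_zero, sub_zero]; abel
    · have hrep0b := E0 (i) le_rfl h0b
      rw [Nat.sub_self] at hrep0b
      have hs1 : nγ + (dγ : ZMod q) + (k : ZMod q) + (nα + (dα : ZMod q) + ((0 : ℕ) : ZMod q)) + (nβ + (dβ : ZMod q) - ((j - i : ℕ) : ZMod q)) = s := by
        rw [Nat.cast_sub h0b, Nat.cast_zero]; linear_combination hxyz
      have hp1 : p = c (nγ + (dγ : ZMod q) + (k : ZMod q)) + a (nα + (dα : ZMod q) + ((0 : ℕ) : ZMod q)) + b (nβ + (dβ : ZMod q) - ((j - i : ℕ) : ZMod q)) := by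
        rw [hrep0b]; abel
      have htop1 : IsStrictTop w (classFin c a b s) p := by rw [hFrr]; exact htop
      have E1 := exchange_fwd_bwd c a b hγ hβ htop1 hk (by omega : j - i ≤ dβ) hs1 hp1
      rcases le_total (j - i) (k) with h1a | h1b
      · have hrep1a := E1 (j - i) h1a le_rfl
        rw [Nat.sub_self] at hrep1a
        refine Or.inl (chain_of_forward hα hβ hγ htop (i := 0) (j := 0) (k := k - (j - i))
          (by omega) (by omega) (by omega) ?_ ?_)
        · rw [Nat.cast_sub h1a, Nat.cast_sub h0b, Nat.cast_zero]; linear_combination hxyz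
        · rw [hrep1a]; simp only [Nat.cast_zero, add_zero, sub_zero]; abel
      · have hrep1b := E1 (k) le_rfl h1b
        rw [Nat.sub_self] at hrep1b
        refine Or.inr (chain_of_backward hα hβ hγ htop (i := 0) (j := j - i - k) (k := 0)
          (by omega) (by omega) (by omega) ?_ ?_)
        · rw [Nat.cast_sub h1b, Nat.cast_sub h0b, Nat.cast_zero]; linear_combination hxyz
        · rw [hrep1b]; simp only [Nat.cast_zero, add_zero, sub_zero]; abel
  · -- F B B
    have hs0 : nα + (dα : ZMod q) + (i : ZMod q) + (nγ + (dγ : ZMod q) - (k : ZMod q)) + (nβ + (dβ : ZMod q) - (j : ZMod q)) = s := by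
      linear_combination hxyz
    have hp0 : p = a (nα + (dα : ZMod q) + (i : ZMod q)) + c (nγ + (dγ : ZMod q) - (k : ZMod q)) + b (nβ + (dβ : ZMod q) - (j : ZMod q)) := by
      rw [hp]; abel
    have htop0 : IsStrictTop w (classFin a c b s) p := by rw [hF23]; exact htop
    have E0 := exchange_fwd_bwd a c b hα hβ htop0 hi hj hs0 hp0
    rcases le_total (j) (i) with h0a | h0b
    · have hrep0a := E0 (j) h0a le_rfl
      rw [Nat.sub_self] at hrep0a
      have hs1 : nα + (dα : ZMod q) + ((i - j : ℕ) : ZMod q) + (nβ + (dβ : ZMod q) - ((0 : ℕ) : ZMod q)) + (nγ + (dγ : ZMod q) - (k : ZMod q)) = s := by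
        rw [Nat.cast_sub h0a, Nat.cast_zero]; linear_combination hxyz
      have hp1 : p = a (nα + (dα : ZMod q) + ((i - j : ℕ) : ZMod q)) + b (nβ + (dβ : ZMod q) - ((0 : ℕ) : ZMod q)) + c (nγ + (dγ : ZMod q) - (k : ZMod q)) := by
        rw [hrep0a]; abel
      have E1 := exchange_fwd_bwd a b c hα hγ htop (by omega : dα + (i - j) < q) hk hs1 hp1
      rcases le_total (k) (i - j) with h1a | h1b
      · have hrep1a := E1 (k) h1a le_rfl
        rw [Nat.sub_self] at hrep1a
        refine Or.inl (chain_of_forward hα hβ hγ htop (i := i - j - k) (j := 0) (k := 0)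
          (by omega) (by omega) (by omega) ?_ ?_)
        · rw [Nat.cast_sub h1a, Nat.cast_sub h0a, Nat.cast_zero]; linear_combination hxyz
        · simpa using hrep1a
      · have hrep1b := E1 (i - j) le_rfl h1b
        rw [Nat.sub_self] at hrep1b
        refine Or.inr (chain_of_backward hα hβ hγ htop (i := 0) (j := 0) (k := k - (i - j))
          (by omega) (by omega) (by omega) ?_ ?_)
        · rw [Nat.cast_sub h1b, Nat.cast_sub h0a, Nat.cast_zero]; linear_combination hxyz
        · simpa using hrep1b
    · have hrep0b := E0 (i) le_rfl h0b
      rw [Nat.sub_self] at hrep0b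
      refine Or.inr (chain_of_backward hα hβ hγ htop (i := 0) (j := j - i) (k := k)
        (by omega) (by omega) hk ?_ ?_)
      · rw [Nat.cast_sub h0b, Nat.cast_zero]; linear_combination hxyz
      · rw [hrep0b]; simp only [Nat.cast_zero, add_zero, sub_zero]; abel
  · -- B F F
    have hs0 : nβ + (dβ : ZMod q) + (j : ZMod q) + (nγ + (dγ : ZMod q) + (k : ZMod q)) + (nα + (dα : ZMod q) - (i : ZMod q)) = s := by
      linear_combination hxyz
    have hp0 : p = b (nβ + (dβ : ZMod q) + (j : ZMod q)) + c (nγ + (dγ : ZMod q) + (k : ZMod q)) + a (nα + (dα : ZMod q) - (i : ZMod q)) := by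
      rw [hp]; abel
    have htop0 : IsStrictTop w (classFin b c a s) p := by rw [hFr]; exact htop
    have E0 := exchange_fwd_bwd b c a hβ hα htop0 hj hi hs0 hp0
    rcases le_total (i) (j) with h0a | h0b
    · have hrep0a := E0 (i) h0a le_rfl
      rw [Nat.sub_self] at hrep0a
      refine Or.inl (chain_of_forward hα hβ hγ htop (i := 0) (j := j - i) (k := k)
        (by omega) (by omega) hk ?_ ?_)
      · rw [Nat.cast_sub h0a, Nat.cast_zero]; linear_combination hxyz
      · rw [hrep0a]; simp only [Nat.cast_zero, add_zero, sub_zero]; abel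
    · have hrep0b := E0 (j) le_rfl h0b
      rw [Nat.sub_self] at hrep0b
      have hs1 : nγ + (dγ : ZMod q) + (k : ZMod q) + (nβ + (dβ : ZMod q) + ((0 : ℕ) : ZMod q)) + (nα + (dα : ZMod q) - ((i - j : ℕ) : ZMod q)) = s := by
        rw [Nat.cast_sub h0b, Nat.cast_zero]; linear_combination hxyz
      have hp1 : p = c (nγ + (dγ : ZMod q) + (k : ZMod q)) + b (nβ + (dβ : ZMod q) + ((0 : ℕ) : ZMod q)) + a (nα + (dα : ZMod q) - ((i - j : ℕ) : ZMod q)) := by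
        rw [hrep0b]; abel
      have htop1 : IsStrictTop w (classFin c b a s) p := by rw [hF13]; exact htop
      have E1 := exchange_fwd_bwd c b a hγ hα htop1 hk (by omega : i - j ≤ dα) hs1 hp1
      rcases le_total (i - j) (k) with h1a | h1b
      · have hrep1a := E1 (i - j) h1a le_rfl
        rw [Nat.sub_self] at hrep1a
        refine Or.inl (chain_of_forward hα hβ hγ htop (i := 0) (j := 0) (k := k - (i - j))
          (by omega) (by omega) (by omega) ?_ ?_)
        · rw [Nat.cast_sub h1a, Nat.cast_sub h0b, Nat.cast_zero]; linear_combination hxyz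
        · rw [hrep1a]; simp only [Nat.cast_zero, add_zero, sub_zero]; abel
      · have hrep1b := E1 (k) le_rfl h1b
        rw [Nat.sub_self] at hrep1b
        refine Or.inr (chain_of_backward hα hβ hγ htop (i := i - j - k) (j := 0) (k := 0)
          (by omega) (by omega) (by omega) ?_ ?_)
        · rw [Nat.cast_sub h1b, Nat.cast_sub h0b, Nat.cast_zero]; linear_combination hxyz
        · rw [hrep1b]; simp only [Nat.cast_zero, add_zero, sub_zero]; abel
  · -- B F B
    have hs0 : nβ + (dβ : ZMod q) + (j : ZMod q) + (nγ + (dγ : ZMod q) - (k : ZMod q)) + (nα + (dα : ZMod q) - (i : ZMod q)) = s := by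
      linear_combination hxyz
    have hp0 : p = b (nβ + (dβ : ZMod q) + (j : ZMod q)) + c (nγ + (dγ : ZMod q) - (k : ZMod q)) + a (nα + (dα : ZMod q) - (i : ZMod q)) := by
      rw [hp]; abel
    have htop0 : IsStrictTop w (classFin b c a s) p := by rw [hFr]; exact htop
    have E0 := exchange_fwd_bwd b c a hβ hα htop0 hj hi hs0 hp0
    rcases le_total (i) (j) with h0a | h0b
    · have hrep0a := E0 (i) h0a le_rfl
      rw [Nat.sub_self] at hrep0a
      have hs1 : nβ + (dβ : ZMod q) + ((j - i : ℕ) : ZMod q) + (nα + (dα : ZMod q) - ((0 : ℕ) : ZMod q)) + (nγ + (dγ : ZMod q) - (k : ZMod q)) = s := by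
        rw [Nat.cast_sub h0a, Nat.cast_zero]; linear_combination hxyz
      have hp1 : p = b (nβ + (dβ : ZMod q) + ((j - i : ℕ) : ZMod q)) + a (nα + (dα : ZMod q) - ((0 : ℕ) : ZMod q)) + c (nγ + (dγ : ZMod q) - (k : ZMod q)) := by
        rw [hrep0a]; abel
      have htop1 : IsStrictTop w (classFin b a c s) p := by rw [hF12]; exact htop
      have E1 := exchange_fwd_bwd b a c hβ hγ htop1 (by omega : dβ + (j - i) < q) hk hs1 hp1
      rcases le_total (k) (j - i) with h1a | h1b
      · have hrep1a := E1 (k) h1a le_rfl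
        rw [Nat.sub_self] at hrep1a
        refine Or.inl (chain_of_forward hα hβ hγ htop (i := 0) (j := j - i - k) (k := 0)
          (by omega) (by omega) (by omega) ?_ ?_)
        · rw [Nat.cast_sub h1a, Nat.cast_sub h0a, Nat.cast_zero]; linear_combination hxyz
        · rw [hrep1a]; simp only [Nat.cast_zero, add_zero, sub_zero]; abel
      · have hrep1b := E1 (j - i) le_rfl h1b
        rw [Nat.sub_self] at hrep1b
        refine Or.inr (chain_of_backward hα hβ hγ htop (i := 0) (j := 0) (k := k - (j - i))
          (by omega) (by omega) (by omega) ?_ ?_)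
        · rw [Nat.cast_sub h1b, Nat.cast_sub h0a, Nat.cast_zero]; linear_combination hxyz
        · rw [hrep1b]; simp only [Nat.cast_zero, add_zero, sub_zero]; abel
    · have hrep0b := E0 (j) le_rfl h0b
      rw [Nat.sub_self] at hrep0b
      refine Or.inr (chain_of_backward hα hβ hγ htop (i := i - j) (j := 0) (k := k)
        (by omega) (by omega) hk ?_ ?_)
      · rw [Nat.cast_sub h0b, Nat.cast_zero]; linear_combination hxyz
      · rw [hrep0b]; simp only [Nat.cast_zero, add_zero, sub_zero]; abel
  · -- B B F
    have hs0 : nγ + (dγ : ZMod q) + (k : ZMod q) + (nβ + (dβ : ZMod q) - (j : ZMod q)) + (nα + (dα : ZMod q) - (i : ZMod q)) = s := by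
      linear_combination hxyz
    have hp0 : p = c (nγ + (dγ : ZMod q) + (k : ZMod q)) + b (nβ + (dβ : ZMod q) - (j : ZMod q)) + a (nα + (dα : ZMod q) - (i : ZMod q)) := by
      rw [hp]; abel
    have htop0 : IsStrictTop w (classFin c b a s) p := by rw [hF13]; exact htop
    have E0 := exchange_fwd_bwd c b a hγ hα htop0 hk hi hs0 hp0
    rcases le_total (i) (k) with h0a | h0b
    · have hrep0a := E0 (i) h0a le_rfl
      rw [Nat.sub_self] at hrep0a
      have hs1 : nγ + (dγ : ZMod q) + ((k - i : ℕ) : ZMod q) + (nα + (dα : ZMod q) - ((0 : ℕ) : ZMod q)) + (nβ + (dβ : ZMod q) - (j : ZMod q)) = s := by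
        rw [Nat.cast_sub h0a, Nat.cast_zero]; linear_combination hxyz
      have hp1 : p = c (nγ + (dγ : ZMod q) + ((k - i : ℕ) : ZMod q)) + a (nα + (dα : ZMod q) - ((0 : ℕ) : ZMod q)) + b (nβ + (dβ : ZMod q) - (j : ZMod q)) := by
        rw [hrep0a]; abel
      have htop1 : IsStrictTop w (classFin c a b s) p := by rw [hFrr]; exact htop
      have E1 := exchange_fwd_bwd c a b hγ hβ htop1 (by omega : dγ + (k - i) < q) hj hs1 hp1
      rcases le_total (j) (k - i) with h1a | h1b
      · have hrep1a := E1 (j) h1a le_rfl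
        rw [Nat.sub_self] at hrep1a
        refine Or.inl (chain_of_forward hα hβ hγ htop (i := 0) (j := 0) (k := k - i - j)
          (by omega) (by omega) (by omega) ?_ ?_)
        · rw [Nat.cast_sub h1a, Nat.cast_sub h0a, Nat.cast_zero]; linear_combination hxyz
        · rw [hrep1a]; simp only [Nat.cast_zero, add_zero, sub_zero]; abel
      · have hrep1b := E1 (k - i) le_rfl h1b
        rw [Nat.sub_self] at hrep1b
        refine Or.inr (chain_of_backward hα hβ hγ htop (i := 0) (j := j - (k - i)) (k := 0)
          (by omega) (by omega) (by omega) ?_ ?_)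
        · rw [Nat.cast_sub h1b, Nat.cast_sub h0a, Nat.cast_zero]; linear_combination hxyz
        · rw [hrep1b]; simp only [Nat.cast_zero, add_zero, sub_zero]; abel
    · have hrep0b := E0 (k) le_rfl h0b
      rw [Nat.sub_self] at hrep0b
      refine Or.inr (chain_of_backward hα hβ hγ htop (i := i - k) (j := j) (k := 0)
        (by omega) hj (by omega) ?_ ?_)
      · rw [Nat.cast_sub h0b, Nat.cast_zero]; linear_combination hxyz
      · rw [hrep0b]; simp only [Nat.cast_zero, add_zero, sub_zero]; abel
  · -- B B B
    exact Or.inr (chain_of_backward hα hβ hγ htop hi hj hk hxyz hp)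

/-- **The mode class.**  If `s = m_α + m_β + m_γ` is the class of the mode triple, the only possible strict `w`-top of class `s`
is the mode point `a m_α + b m_β + c m_γ` (forward offsets sum to `0`; backward offsets `< q` summing to `0 mod q` vanish too).
[folklore] -/
theorem eq_modes_of_isStrictTop {w : Fin 2 → ℝ} {nα nβ nγ : ZMod q} {dα dβ dγ : ℕ}
    (hα : CycUnimodalAt (fun x => w ⬝ᵥ a x) nα dα) (hβ : CycUnimodalAt (fun y => w ⬝ᵥ b y) nβ dβ)
    (hγ : CycUnimodalAt (fun z => w ⬝ᵥ c z) nγ dγ) {p : Fin 2 → ℝ}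
    (htop : IsStrictTop w (classFin a b c (nα + (dα : ZMod q) + (nβ + (dβ : ZMod q)) + (nγ + (dγ : ZMod q)))) p) :
    p = a (nα + (dα : ZMod q)) + b (nβ + (dβ : ZMod q)) + c (nγ + (dγ : ZMod q)) := by
  rcases exists_triple_chain_of_isStrictTop hα hβ hγ htop with
    ⟨i, j, k, -, -, -, hlt, hs, hp⟩ | ⟨i, j, k, -, -, -, hlt, hs, hp⟩
  · have h0 : ((i + j + k : ℕ) : ZMod q) = 0 := by
      have := hs; rw [add_eq_left] at this; exact this
    have hzero : i + j + k = 0 := by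
      rw [ZMod.natCast_eq_zero_iff] at h0
      exact Nat.eq_zero_of_dvd_of_lt h0 hlt
    obtain ⟨hi, hj, hk⟩ : i = 0 ∧ j = 0 ∧ k = 0 := by omega
    subst hi; subst hj; subst hk
    simpa using hp
  · have h0 : ((i + j + k : ℕ) : ZMod q) = 0 := by
      have := hs; rw [sub_eq_self] at this; exact this
    have hzero : i + j + k = 0 := by
      rw [ZMod.natCast_eq_zero_iff] at h0
      exact Nat.eq_zero_of_dvd_of_lt h0 hlt
    obtain ⟨hi, hj, hk⟩ : i = 0 ∧ j = 0 ∧ k = 0 := by omega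
    subst hi; subst hj; subst hk
    simpa using hp

end TripleChains

end TotalsLaw

end Summit.ValiantsHypothesis.ValiantsHypothesis.Theorems.NewtonUnitEquationsDissociatedUniform
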